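import Literature.Topology.PlaneTopology.Schoenflies
import HarnessLib

/-!
# Radial Schoenflies families of a Dobrushin domain: nested Jordan approximants from inside and
# outside with the SAME boundary parametrisation (piece (G2⁗) of stub 5a4′ `stub_carvedReduction_squeeze`)

Piece of stub 5a4′ `stub_carvedReduction_squeeze` (`TwoPieceAdmRestrictionLimit → MovingCarvingSqueeze`)
of the line `bridge-gate-renewal` (r9) of the crux `SAWDefectDecoherence.ObservableToSLER`
(stmt-CriticalPhenomena-14005; twin T2b′/T2b″ of stmt-CriticalPhenomena-10472).

WHY IT IS NEEDED (the drift of the pinned frame).  The conclusion `MovingCarvingSqueeze` pins the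
lattice: the inner admissible family `Λ'` of the FIXED two-piece flat domain `M` has EXACT rows in
the balls at `M.pt i`, the translated gate vertex `q_j - x_j` belongs to `Λ' (δ_j) ⊆ M`, and the
rescaled gate mid-edges converge to `M.pt 0`; hence the translated gate row approaches the window
height `im (M.pt 0)` from above within a third of a zigzag, so the row component of the translation
`x_j` is forced up to `O(1)` rows and the translated domain `D - δ_j • x_j = (D - τ) - ε_j` DRIFTS
by `ε_j → 0` with `|ε_j|` of the order of the (uncontrolled) speed of convergence of the gate
heights — in general `|ε_j| ≫ δ_j`.  Every fixed outer domain to which ARL″ is applied must contain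
the translated carved lattice points, among them a layer of width `|ε_j|` OUTSIDE `D - τ` along
`∂(D - τ)`: the common super-domain cannot be cut out of `D - τ` itself but out of a Jordan domain
containing `closure (D - τ)` whose boundary loop is `η`-close to that of `D - τ` IN PARAMETRISATION
(the conclusion also asks `dist (M.boundary t + τ) (D.boundary t) ≤ η` for the inner domain).  This
file provides both approximants at once, for every Dobrushin domain, as members of ONE radial
family:

* `stub_carvedReduction_jordanApprox` (the only declaration; the radial dilates are built inside
  its proof) — for a Dobrushin domain `D` there are a homeomorphism
  `H : ℂ ≃ₜ ℂ` (a Schoenflies homeomorphism of a Carathéodory chart,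
  `JordanDomain.DiscChart.exists_homeomorph_eqOn`), a loop `u : ℝ → 𝕋` with `H ∘ u = D.boundary`,
  and Dobrushin domains `D_r` (`r > 0`) with carrier `H '' ball 0 r`, boundary loop
  `t ↦ H (r • u t)` and the marks of `D`; so `D_1` has the carrier, loop and marked points of `D`,
  `closure D_r = H '' closedBall 0 r ⊆ D_s` for `r < s` (so `D_r ↑ D` as `r ↑ 1` and
  `D_r ↓ closure D` as `r ↓ 1`), and, `H` being uniformly continuous on `closedBall 0 2` (last
  clause, quantified), `D_r.boundary → D.boundary` and `D_r.pt i → D.pt i` uniformly as `r → 1`.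

Sources: Ch. Pommerenke, Boundary Behaviour of Conformal Maps (1992), §2.3 Cor. 2.8–2.9;
R. H. Bing, The Geometric Topology of 3-Manifolds (1983), §III.6.
-/

noncomputable section

open Set Filter Metric Bornology Function Complex
open _root_.Topology
open Literature.Probability.RandomPlanarGeometry
open Literature.Topology.PlaneTopology

namespace Summit.CriticalPhenomena.SAWScalingLimit.Theorems.ObservableToSLER.Squeeze

/-- **Registered sub-goal `stub_carvedReduction_jordanApprox`** (crux item stmt-CriticalPhenomena-14005,
stub 5a4′ `stub_carvedReduction_squeeze`, piece (G2⁗) RADIAL SCHOENFLIES FAMILY): for every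
Dobrushin domain `D` there are a homeomorphism `H` of `ℂ`, a unit loop `u` with
`H (u t) = D.boundary t`, and Dobrushin domains `D_r`, `r > 0`, with carrier `H '' ball 0 r`,
the marks of `D` and boundary loop `t ↦ H (r u t)`; `H` maps the unit disc onto `D`, the unit
circle onto `∂D`, the outside of the closed unit disc onto `(closure D)ᶜ`, and is uniformly
continuous on `closedBall 0 2` (quantified). [cite: PommerenkeBBCM1992, §2.3 Cor. 2.8 (p. 25)] -/
theorem stub_carvedReduction_jordanApprox :
    ∀ (D : DobrushinDomain), ∃ (H : ℂ ≃ₜ ℂ) (u : ℝ → ℂ) (Dr : ℝ → DobrushinDomain),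
      (∀ t, u t ∈ sphere (0 : ℂ) 1) ∧ Continuous u ∧ Periodic u 1 ∧ InjOn u (Ico 0 1) ∧
      range u = sphere 0 1 ∧ (∀ t, H (u t) = D.boundary t) ∧
      H '' ball 0 1 = D.carrier ∧ H '' sphere 0 1 = frontier D.carrier ∧
      H '' closedBall 0 1 = closure D.carrier ∧ H '' (closedBall 0 1)ᶜ = (closure D.carrier)ᶜ ∧
      (∀ r, 0 < r → (Dr r).carrier = H '' ball 0 r ∧ (Dr r).mark = D.mark ∧
        (∀ t, (Dr r).boundary t = H ((r : ℂ) * u t)) ∧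
        ∀ i, (Dr r).pt i = H ((r : ℂ) * u (D.mark i))) ∧
      (∀ i, D.pt i = H (u (D.mark i))) ∧
      (Dr 1).carrier = D.carrier ∧
      (∀ r, 0 < r → closure (Dr r).carrier = H '' closedBall 0 r ∧
        frontier (Dr r).carrier = H '' sphere 0 r) ∧
      (∀ r s, 0 < r → r ≤ s → (Dr r).carrier ⊆ (Dr s).carrier) ∧
      (∀ r s, 0 < r → r < s → closure (Dr r).carrier ⊆ (Dr s).carrier) ∧
      (∀ η > (0 : ℝ), ∃ ε > (0 : ℝ), ∀ z w : ℂ, ‖z‖ ≤ 2 → ‖w‖ ≤ 2 → dist z w ≤ ε →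
        dist (H z) (H w) ≤ η) := by
  intro D
  classical
  obtain ⟨z₀, hz₀⟩ := D.nonempty
  obtain ⟨C, -⟩ := D.exists_discChart_apply_eq hz₀
  obtain ⟨H, -, hball, hsph, hcl, hext⟩ := C.exists_homeomorph_eqOn
  -- the unit loop `u = H⁻¹ ∘ D.boundary`
  set u : ℝ → ℂ := fun t => H.symm (D.boundary t) with hudef
  have hu : ∀ t, u t ∈ sphere (0 : ℂ) 1 := by
    intro t
    have ht : D.boundary t ∈ frontier D.carrier := D.boundary_mem_frontier t
    rw [← hsph] at ht
    obtain ⟨ζ, hζ, hζt⟩ := ht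
    rw [hudef]
    simp only
    rw [← hζt, H.symm_apply_apply]
    exact hζ
  have huc : Continuous u := H.symm.continuous.comp D.continuous_boundary
  have hup : Periodic u 1 := fun t => by
    show H.symm (D.boundary (t + 1)) = H.symm (D.boundary t)
    rw [D.periodic_boundary t]
  have hui : InjOn u (Ico 0 1) := fun s hs t ht hst =>
    D.injOn_boundary hs ht (H.symm.injective hst)
  have hHu : ∀ t, H (u t) = D.boundary t := fun t => H.apply_symm_apply _
  have hur : range u = sphere 0 1 := by
    refine (range_subset_iff.2 hu).antisymm fun ζ hζ => ?_
    have : H ζ ∈ frontier D.carrier := hsph ▸ mem_image_of_mem H hζ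
    rw [← D.range_boundary] at this
    obtain ⟨t, ht⟩ := this
    exact ⟨t, by rw [hudef]; simp only; rw [ht, H.symm_apply_apply]⟩
  -- the radial dilates `H '' ball 0 r` as Dobrushin domains with the marks of `D`
  have hsphr : ∀ r : ℝ, 0 < r → (fun w : ℂ => (r : ℂ) * w) '' sphere 0 1 = sphere (0 : ℂ) r := by
    intro r hr
    have hr0 : (r : ℂ) ≠ 0 := Complex.ofReal_ne_zero.2 hr.ne'
    ext z
    simp only [mem_image, mem_sphere_zero_iff_norm]
    constructor
    · rintro ⟨w, hw, rfl⟩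
      rw [norm_mul, Complex.norm_real, Real.norm_of_nonneg hr.le, hw, mul_one]
    · intro hz
      refine ⟨(r : ℂ)⁻¹ * z, ?_, by rw [← mul_assoc, mul_inv_cancel₀ hr0, one_mul]⟩
      rw [norm_mul, norm_inv, Complex.norm_real, Real.norm_of_nonneg hr.le, hz,
        inv_mul_cancel₀ hr.ne']
  let rad : ∀ r : ℝ, 0 < r → DobrushinDomain := fun r hr =>
    { carrier := H '' ball 0 r
      boundary := fun t => H ((r : ℂ) * u t)
      isOpen := H.isOpenMap _ isOpen_ball
      isBounded := ((isCompact_closedBall (0 : ℂ) r).image H.continuous).isBounded.subset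
        (image_mono ball_subset_closedBall)
      isConnected := ((convex_ball (0 : ℂ) r).isConnected (by simp [hr])).image H
        H.continuous.continuousOn
      continuous_boundary := H.continuous.comp (continuous_const.mul huc)
      periodic_boundary := fun t => by
        show H ((r : ℂ) * u (t + 1)) = H ((r : ℂ) * u t)
        rw [hup t]
      injOn_boundary := by
        intro s hs t ht hst
        have h1 : (r : ℂ) * u s = (r : ℂ) * u t := H.injective hst
        exact hui hs ht (mul_left_cancel₀ (Complex.ofReal_ne_zero.2 hr.ne') h1)
      range_boundary := by
        have : (fun t => H ((r : ℂ) * u t)) = H ∘ (fun w : ℂ => (r : ℂ) * w) ∘ u := rfl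
        rw [this, range_comp, range_comp, hur, hsphr r hr, ← H.image_frontier,
          frontier_ball _ hr.ne']
      mark := D.mark
      strictMono_mark := D.strictMono_mark
      mark_mem := D.mark_mem }
  set Dr : ℝ → DobrushinDomain := fun r => if hr : 0 < r then rad r hr else D with hDr
  have hDr' : ∀ r (hr : 0 < r), Dr r = rad r hr := fun r hr => by
    rw [hDr]; simp only [dif_pos hr]
  have hcar : ∀ r, 0 < r → (Dr r).carrier = H '' ball 0 r := fun r hr => by
    rw [hDr' r hr]
  refine ⟨H, u, Dr, hu, huc, hup, hui, hur, hHu, hball, hsph, hcl, hext, ?_, ?_, ?_, ?_, ?_, ?_, ?_⟩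
  · intro r hr
    exact ⟨hcar r hr, by rw [hDr' r hr], fun t => by rw [hDr' r hr], fun i => by rw [hDr' r hr]; rfl⟩
  · intro i
    show D.boundary (D.mark i) = H (u (D.mark i))
    rw [hHu]
  · rw [hcar 1 one_pos, hball]
  · intro r hr
    rw [hcar r hr, ← H.image_closure, closure_ball _ hr.ne', ← H.image_frontier,
      frontier_ball _ hr.ne']
    exact ⟨rfl, rfl⟩
  · intro r s hr hrs
    rw [hcar r hr, hcar s (hr.trans_le hrs)]
    exact image_mono (ball_subset_ball hrs)
  · intro r s hr hrs
    rw [hcar r hr, hcar s (hr.trans hrs), ← H.image_closure, closure_ball _ hr.ne']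
    exact image_mono (closedBall_subset_ball hrs)
  · -- uniform continuity of `H` on the compact `closedBall 0 2`
    intro η hη
    have huc' : UniformContinuousOn H (closedBall (0 : ℂ) 2) :=
      (isCompact_closedBall (0 : ℂ) 2).uniformContinuousOn_of_continuous H.continuous.continuousOn
    rw [Metric.uniformContinuousOn_iff_le] at huc'
    obtain ⟨ε, hε, h⟩ := huc' η hη
    exact ⟨ε, hε, fun z w hz hw hzw => h z (mem_closedBall_zero_iff.2 hz) w
      (mem_closedBall_zero_iff.2 hw) hzw⟩

end Summit.CriticalPhenomena.SAWScalingLimit.Theorems.ObservableToSLER.Squeeze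

end
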